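import Literature.Geometry.Symplectic.TwoHandleIsotopyProofs
import Literature.Geometry.Symplectic.TwoHandleIsotopyAmbient
import Literature.Topology.FourManifolds.AttachingMapBoundaryTube
import Literature.Topology.FourManifolds.CircleTubeUniqueness
import Literature.Topology.FourManifolds.AttachingMapAdaptedFlowout
import Literature.Topology.FourManifolds.BoundaryCollarMatching
import Literature.Topology.FourManifolds.CollarExtension
import Literature.Topology.FourManifolds.DehnSurgeryRotationField
import Literature.Topology.PlaneTopology.ChartParity
import HarnessLib

/-!
# Isotopy invariance of 2-handle attachment (ISO proved)

Topic `Literature/Geometry/Symplectic`.  This file **discharges the named fact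
`HandleAttachingMap.isMultiAttachment_of_linkIsotopyInBoundary`** of `TwoHandleIsotopy.lean`
(`HandleAttachingMap.isMultiAttachment_of_linkIsotopyInBoundary_holds`): attaching 2-handles to a
compact 4-manifold `W` along attaching maps whose attaching circles are isotopic through links in
`∂W`, with the handle framings carried along the isotopy, gives the same manifold (Kosinski,
*Differential Manifolds* (1993), VI §6 and VIII, proof of (1.2): *"since `Σ₂` is isotopic to
`S`, `W₂` can be obtained by attaching a handle along `S` instead"*).

`TwoHandleIsotopyReduction.lean` reduced the statement (Step 1, fed with the ambient isotopy
theorem `exists_diffeotopy_of_linkIsotopyInBoundary` of `TwoHandleIsotopyAmbient.lean` and the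
framing bookkeeping `framingHomotopic_mfderiv_of_diffeotopy`) to the case of two families `g`,
`h̄` of attaching maps **with the same attaching circles and homotopic handle framings**
(`exists_isMultiAttachment_sameCircle`).  This case (`isMultiAttachment_of_sameCircle'`, Step 2;
Kosinski VI §5: the manifold *"depends on the choice of imbeddings `h₁, h₂`, but not on the choice
of extensions `h̄₁, h̄₂` … a version of the Uniqueness of Collars Theorem"*, together with the
uniqueness of tubular neighbourhoods III (3.5)) is proved here by producing a self-diffeomorphism
`Ξ` of `W` with `Ξ ∘ g i = h̄ i ∘ μ_i` near the attaching circles, `μ_i` the reflection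
`muReflection` of the second normal coordinate of the model handle
(`exists_diffeomorph_eq_reframe`), after which locality (`IsMultiAttachment.of_eqOn_near_sphere`)
and symmetry (`isMultiAttachment_reframe_iff`) conclude.  `Ξ = G ∘ Ψ` with:

* `Ψ` **matching the collars adapted to `g` and to `h̄`** (`exists_adapted_flowout`,
  `AttachingMapAdaptedFlowout.lean`: flow-outs of `∂W` whose lines through the sphere parts of the
  tubes are the depth lines of the attaching maps; `OpenCollarData.exists_diffeomorph_apply_eq`,
  `BoundaryCollarMatching.lean`: uniqueness of collars), so that `Ψ ∘ g i` is the prolongation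
  along the `h̄`-collar of the boundary tube `g♭ i` of `g i` (`AttachingMapBoundaryTube.lean`);
* `G` **the slide over the `h̄`-collar** (`BoundaryData.Collar.slideExtension`,
  `CollarExtension.lean`) of a diffeotopy `D` of the closed 3-manifold `∂W` with
  `D₁ ∘ g♭ i = h♭ i ∘ (reflection)` near the zero sections: on each component the uniqueness of
  tubes around a circle up to a fibre reflection (`CircleTube.exists_diffeotopy_reflect`,
  `CircleTubeUniqueness.lean`, supported in the target of `h♭ i`, these being pairwise disjoint),
  composed over the components (`exists_diffeotopy_family`).

The hypothesis of `CircleTube.exists_diffeotopy_reflect` — the rotation field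
`u(x) = A(x)e₀/‖A(x)e₀‖` of the transition `h♭⁻¹ ∘ g♭` has a smooth angle function — is the
content of the first half of the file (**homotopic handle framings give a rotation field of degree
zero**, `exists_angle_of_framingHomotopic`; roadmap step 4 of `TwoHandleIsotopy.lean`): every
framing `ν` of `K` read through the differential of the fibre coordinate `x_μ ∘ h̄⁻¹`
(`fibreCoord`) is a nowhere-vanishing plane field along `K` (`mfderiv_fibreCoord_ne_zero`: `ν` is
tangent to `∂W` and nowhere tangent to `K`, while the kernel of `d(x_μ ∘ h̄⁻¹)` on `T∂W` along `K`
is `TK`), jointly continuous along a framing family (`continuousOn_mfderiv_fibreCoord_family`,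
Mathlib's `tangentMapWithin`); for the handle framing of `g` it is the first column `A(x)e₀` of
the fibre derivative (`mfderiv_fibreCoord_attachingFraming`: the handle framing is the velocity of
`g` along the arc `s ↦ (cos s θ, sin s, 0)` of `∂D⁴`, `attachingFraming_eq_mfderiv_comp_tubeArcPt`,
and this arc is the sphere point of fibre `sin s e₀`), for that of `h̄` it is the constant `e₀`;
so along a homotopy of framings `wind (A e₀) = wind (e₀) = 0` (`wind_eq_of_homotopy`,
`PlaneTopology/ChartParity.lean`), and the degree `d` of `u` produced by
`exists_int_angle_of_rotationField` (`DehnSurgeryRotationField.lean`) vanishes (Gompf–Stipsicz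
(1999), §4.5: framings of a knot differ by maps `S¹ → SO(2)`, classified by the degree).

Everything here is proved; no named fact is introduced.

## References

* A. A. Kosinski, *Differential Manifolds*, Academic Press (1993), III (3.5), VI §5, §6, VIII
  proof of (1.2). [Kosinski1993]
* R. E. Gompf, A. I. Stipsicz, *4-Manifolds and Kirby Calculus*, GSM 20 (1999), §4.5.
  [GompfStipsicz1999]
* R. C. Kirby, *The Topology of 4-Manifolds*, LNM 1374 (1989), Ch. I §2. [Kirby1989]
-/

noncomputable section

open scoped Manifold ContDiff Topology Bundle
open Set Function Bundle Filter Metric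

namespace Literature.Geometry.Symplectic

open Literature.Topology.FourManifolds Literature.Topology.PlaneTopology

universe u

/-- The model vector space `ℝ⁴` of the tangent spaces. [folklore] -/
local notation "E4" => EuclideanSpace ℝ (Fin 4)
/-- Local notation: `𝔼 n` is the model Euclidean space `EuclideanSpace ℝ (Fin n)`. -/
local notation "𝔼 " n:arg => EuclideanSpace ℝ (Fin n)
/-- Local notation: `𝕊 n` is the unit sphere in `EuclideanSpace ℝ (Fin (n + 1))`. -/
local notation "𝕊 " n:arg => (Metric.sphere (0 : EuclideanSpace ℝ (Fin (n + 1))) 1)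
/-- Local notation: `𝔻 n` is the closed unit ball in `EuclideanSpace ℝ (Fin n)`. -/
local notation "𝔻 " n:arg => (Metric.closedBall (0 : EuclideanSpace ℝ (Fin n)) 1)
set_option quotPrecheck false in
/-- Local notation: Kosinski's tube `T ⊆ D⁴` of the circle `S¹ × 0`, as a type. -/
local notation "𝕋" => ↥(handleTube 3 2)
/-- Local notation: the model with corners of the tube `S¹ × ℝ²`. -/
local notation "I𝕋₁" => (ModelWithCorners.prod (𝓡 1) 𝓘(ℝ, EuclideanSpace ℝ (Fin 2)))

attribute [local instance] fact_finrank_euclideanSpace_succ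


/-! ### The transition of a tube with itself -/

section Self

variable {Y : Type*} [TopologicalSpace Y] [ChartedSpace (𝔼 3) Y]

/-- **The fibre derivative of the transition of a tube with itself is the identity** (the
transition map is the identity near the zero section). [folklore] -/
theorem fibreDeriv_self (Φ : CircleTube Y) (x : 𝕊 1) :
    CircleTube.fibreDeriv Φ Φ x = ContinuousLinearMap.id ℝ (𝔼 2) := by
  unfold CircleTube.fibreDeriv
  have hev : (fun w : 𝔼 2 => (CircleTube.transition Φ Φ (x, w)).2) =ᶠ[𝓝 0] id := by
    have h1 : ball (0 : 𝔼 2) 1 ∈ 𝓝 (0 : 𝔼 2) := isOpen_ball.mem_nhds (mem_ball_self one_pos)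
    filter_upwards [h1] with w hw
    rw [mem_ball_zero_iff] at hw
    show (Φ.toHomeo.symm (Φ.toHomeo (x, w))).2 = w
    rw [Φ.symm_apply_apply (Φ.mem_source_iff.2 hw)]
  rw [hev.fderiv_eq, fderiv_id]

/-- The first column of the fibre derivative of a tube with itself is `e₀`. [folklore] -/
theorem frameCol_self (Φ : CircleTube Y) (x : 𝕊 1) : CircleTube.frameCol Φ Φ x = planeE0 := by
  rw [CircleTube.frameCol, fibreDeriv_self, ContinuousLinearMap.id_apply]

end Self

/-! ### The fibre coordinate of an attaching map and framings read through it -/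

section FibreCoord

variable {W : Type u} [TopologicalSpace W] [ChartedSpace (EuclideanHalfSpace 4) W]

/-- **The fibre coordinate `x_μ ∘ h̄⁻¹ : W → ℝ²` of an attaching map** (junk off the range).
[folklore] -/
def fibreCoord (h : HandleAttachingMap 3 2 W) (z : W) : 𝔼 2 := tubeFibre (h.toHomeo.symm z)

/-- The fibre coordinate is smooth on the range. [folklore] -/
theorem contMDiffOn_fibreCoord (h : HandleAttachingMap 3 2 W) :
    ContMDiffOn (𝓡∂ 4) 𝓘(ℝ, 𝔼 2) ∞ (fibreCoord h) (range h.toFun) :=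
  contMDiff_tubeFibre.comp_contMDiffOn h.contMDiffOn_toHomeo_symm

/-- The fibre coordinate is smooth at the points of the range. [folklore] -/
theorem contMDiffAt_fibreCoord (h : HandleAttachingMap 3 2 W) {z : W} (hz : z ∈ range h.toFun) :
    ContMDiffAt (𝓡∂ 4) 𝓘(ℝ, 𝔼 2) ∞ (fibreCoord h) z :=
  (contMDiffOn_fibreCoord h).contMDiffAt (h.isOpen_range.mem_nhds hz)

/-- The attaching circle lies in the range. [folklore] -/
theorem attachingCircle_mem_range (h : HandleAttachingMap 3 2 W) (θ : 𝕊 1) :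
    h.attachingCircle θ ∈ range h.toFun := ⟨_, rfl⟩

variable [IsManifold (𝓡∂ 4) ∞ W]

/-- **The fibre component of the transition of two boundary tubes is the fibre coordinate of the
second attaching map along the first** (definitional). [folklore] -/
theorem transition_boundaryTube_snd (g h : HandleAttachingMap 3 2 W) (θ : 𝕊 1) (w : 𝔼 2) :
    (CircleTube.transition g.boundaryTube h.boundaryTube (θ, w)).2 =
      (fibreCoord h) (g.toFun (depthLine θ w 0)) := rfl

/-- The arc `s ↦ (cos s θ, sin s, 0)` of `∂D⁴` is the sphere point of angle `θ` and fibre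
`sin s e₀` (where `cos s > 0`). [folklore] -/
theorem tubeArcPt_eq_depthLine {θ : 𝕊 1} {s : ℝ} (hs : 0 < Real.cos s) :
    tubeArcPt θ s = depthLine θ (Real.sin s • planeE0) 0 := by
  have h := depthLine_tube (tubeArcPt θ s)
  rw [tubeAngle_tubeArcPt hs, tubeFibre_tubeArcPt hs, tubeDepth_tubeArcPt] at h
  rw [← h]
  rfl

/-- **The handle framing of `g` read through the fibre coordinate of `h̄` is the first column
`A(θ)e₀` of the fibre derivative of the transition `h♭⁻¹ ∘ g♭`** (for attaching maps with the
same attaching circle): the handle framing is the velocity of `g` along the arc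
`s ↦ (cos s θ, sin s, 0)` (`attachingFraming_eq_mfderiv_comp_tubeArcPt`), which is the sphere
point of fibre `sin s e₀`, so by the chain rule its image is `∂_w (x_μ h̄⁻¹ g♭)(θ, 0) e₀`.
[cite: Kosinski1993, VI §5] -/
theorem mfderiv_fibreCoord_attachingFraming (g h : HandleAttachingMap 3 2 W)
    (hcirc : g.attachingCircle = h.attachingCircle) (θ : 𝕊 1) :
    mfderiv (𝓡∂ 4) 𝓘(ℝ, 𝔼 2) (fibreCoord h) (h.attachingCircle θ) (g.attachingFraming θ) =
      CircleTube.frameCol g.boundaryTube h.boundaryTube θ := by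
  have hcore : ∀ x, g.boundaryTube.core x = h.boundaryTube.core x :=
    HandleAttachingMap.boundaryTube_core_eq hcirc
  -- the fibre map `G w = x_μ h̄⁻¹ g (depthLine θ w 0)` and its derivative at `0`
  set G : 𝔼 2 → 𝔼 2 := fun w => (CircleTube.transition g.boundaryTube h.boundaryTube (θ, w)).2
    with hG_def
  have hGd : DifferentiableAt ℝ G 0 := by
    have h1 : MDifferentiableAt 𝓘(ℝ, 𝔼 2) 𝓘(ℝ, 𝔼 2) G 0 :=
      (mdifferentiableAt_snd (I := 𝓡 1) (I' := 𝓘(ℝ, 𝔼 2))).comp 0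
        (CircleTube.mdifferentiableAt_transition_fibre hcore θ)
    exact mdifferentiableAt_iff_differentiableAt.1 h1
  have hcol : CircleTube.frameCol g.boundaryTube h.boundaryTube θ = fderiv ℝ G 0 planeE0 := rfl
  -- the curve `s ↦ G (sin s • e₀)` has velocity `fderiv G 0 e₀` at `s = 0`
  have hsin : HasDerivAt (fun s : ℝ => Real.sin s • planeE0) planeE0 0 := by
    have h := (Real.hasDerivAt_sin 0).smul_const planeE0
    rwa [Real.cos_zero, one_smul] at h
  have hcurve : HasDerivAt (fun s : ℝ => G (Real.sin s • planeE0)) (fderiv ℝ G 0 planeE0) 0 := by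
    have hG0 : HasFDerivAt G (fderiv ℝ G 0) (Real.sin (0 : ℝ) • planeE0) := by
      rw [Real.sin_zero, zero_smul]; exact hGd.hasFDerivAt
    exact HasFDerivAt.comp_hasDerivAt (x := (0 : ℝ)) (f := fun s : ℝ => Real.sin s • planeE0) hG0 hsin
  -- the handle framing is the velocity of `g` along the arc
  rw [attachingFraming_eq_mfderiv_comp_tubeArcPt]
  have hγc : ContMDiffAt 𝓘(ℝ, ℝ) (𝓡∂ 4) ∞ (tubeArcPt θ) 0 :=
    contMDiffAt_tubeArcPt (by rw [Real.cos_zero]; exact one_pos)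
  have hγ : MDifferentiableAt 𝓘(ℝ, ℝ) (𝓡∂ 4) (g.toFun ∘ tubeArcPt θ) 0 :=
    (mdifferentiableAt_handleAttachingMap g _).comp 0 (hγc.mdifferentiableAt (by simp))
  have h0 : (g.toFun ∘ tubeArcPt θ) 0 = h.attachingCircle θ := by
    rw [comp_apply, tubeArcPt_zero, ← hcirc]; rfl
  have hP : MDifferentiableAt (𝓡∂ 4) 𝓘(ℝ, 𝔼 2) (fibreCoord h) ((g.toFun ∘ tubeArcPt θ) 0) := by
    rw [h0]
    exact (contMDiffAt_fibreCoord h (attachingCircle_mem_range h θ)).mdifferentiableAt (by simp)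
  have hchain := mfderiv_comp 0 hP hγ
  -- move the base point of `d(fibreCoord)` from `(g ∘ arc) 0` to `K θ`
  have hbase : mfderiv (𝓡∂ 4) 𝓘(ℝ, 𝔼 2) (fibreCoord h) (h.attachingCircle θ)
      (mfderiv 𝓘(ℝ, ℝ) (𝓡∂ 4) (g.toFun ∘ tubeArcPt θ) 0 (1 : ℝ)) =
      mfderiv 𝓘(ℝ, ℝ) 𝓘(ℝ, 𝔼 2) ((fibreCoord h) ∘ (g.toFun ∘ tubeArcPt θ)) 0 (1 : ℝ) := by
    rw [hchain]
    exact congrArg (fun z : W => mfderiv (𝓡∂ 4) 𝓘(ℝ, 𝔼 2) (fibreCoord h) z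
      (mfderiv 𝓘(ℝ, ℝ) (𝓡∂ 4) (g.toFun ∘ tubeArcPt θ) 0 (1 : ℝ))) h0.symm
  rw [hbase]
  -- near `s = 0` the composite curve is `s ↦ G (sin s • e₀)`
  have hev : ((fibreCoord h) ∘ (g.toFun ∘ tubeArcPt θ)) =ᶠ[𝓝 0]
      fun s : ℝ => G (Real.sin s • planeE0) := by
    filter_upwards [eventually_cos_pos] with s hs
    show (fibreCoord h) (g.toFun (tubeArcPt θ s)) = _
    rw [tubeArcPt_eq_depthLine hs]
    rfl
  have hmf : HasMFDerivAt 𝓘(ℝ, ℝ) 𝓘(ℝ, 𝔼 2) ((fibreCoord h) ∘ (g.toFun ∘ tubeArcPt θ)) 0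
      (ContinuousLinearMap.smulRight (1 : ℝ →L[ℝ] ℝ) (fderiv ℝ G 0 planeE0)) :=
    hasMFDerivAt_iff_hasFDerivAt.2 (hcurve.congr_of_eventuallyEq hev).hasFDerivAt
  rw [hmf.mfderiv, hcol]
  show (1 : ℝ) • fderiv ℝ G 0 planeE0 = fderiv ℝ G 0 planeE0
  rw [one_smul]

/-- **The handle framing of `h̄` read through its own fibre coordinate is the constant `e₀`.**
[folklore] -/
theorem mfderiv_fibreCoord_attachingFraming_self (h : HandleAttachingMap 3 2 W) (θ : 𝕊 1) :
    mfderiv (𝓡∂ 4) 𝓘(ℝ, 𝔼 2) (fibreCoord h) (h.attachingCircle θ) (h.attachingFraming θ) =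
      planeE0 := by
  rw [mfderiv_fibreCoord_attachingFraming h h rfl, frameCol_self]

/-! ### Framings read through the fibre coordinate never vanish -/

/-- **The attaching circle lifted to the boundary 3-manifold `∂W`** (as points of the subtype
`↥(∂W)`, so that its image in `W` is the attaching circle definitionally). [folklore] -/
def liftPt (h : HandleAttachingMap 3 2 W) (θ : 𝕊 1) : ↥((𝓡∂ 4).boundary W) :=
  ⟨h.attachingCircle θ, h.isBoundaryPoint_attachingCircle θ⟩

omit [IsManifold (𝓡∂ 4) ∞ W] in
/-- The lifted attaching circle projects to the attaching circle. [folklore] -/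
@[simp] theorem coe_liftPt (h : HandleAttachingMap 3 2 W) (θ : 𝕊 1) :
    ((liftPt h θ : ↥((𝓡∂ 4).boundary W)) : W) = h.attachingCircle θ := rfl

/-- The lifted attaching circle is the core of the boundary tube. [folklore] -/
theorem liftPt_eq_core (h : HandleAttachingMap 3 2 W) (θ : 𝕊 1) :
    liftPt h θ = h.boundaryTube.core θ :=
  Subtype.ext (h.coe_boundaryTube_core θ).symm

/-- The lifted attaching circle lies in the target of the boundary tube. [folklore] -/
theorem liftPt_mem_target (h : HandleAttachingMap 3 2 W) (θ : 𝕊 1) :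
    liftPt h θ ∈ h.boundaryTube.toHomeo.target := by
  rw [liftPt_eq_core]; exact h.boundaryTube.core_mem_target θ

/-- **A framing read through the fibre coordinate, computed in `∂W`**: for `ν` tangent to `∂W`,
`d(x_μ h̄⁻¹)(ν) = (d(h♭⁻¹)(ν₀)).2` with `ν = (0, ν₀)`. [folklore] -/
theorem mfderiv_fibreCoord_eq_snd_mfderiv_symm (h : HandleAttachingMap 3 2 W) {ν : 𝕊 1 → E4}
    (hν : IsKnotFraming h.attachingCircle ν) (θ : 𝕊 1) :
    mfderiv (𝓡∂ 4) 𝓘(ℝ, 𝔼 2) (fibreCoord h) (h.attachingCircle θ) (ν θ) =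
      (mfderiv (𝓡 3) I𝕋₁ h.boundaryTube.toHomeo.symm (liftPt h θ) (tailFraming ν θ)).2 := by
  have hQ : MDifferentiableAt (𝓡 3) I𝕋₁ h.boundaryTube.toHomeo.symm (liftPt h θ) :=
    (h.boundaryTube.contMDiffAt_symm (liftPt_mem_target h θ)).mdifferentiableAt (by simp)
  have hP : MDifferentiableAt (𝓡∂ 4) 𝓘(ℝ, 𝔼 2) (fibreCoord h) (h.attachingCircle θ) :=
    (contMDiffAt_fibreCoord h (attachingCircle_mem_range h θ)).mdifferentiableAt (by simp)
  -- `d(fibreCoord ∘ val) = d(fibreCoord) ∘ (0, ·)`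
  have h1 : HasMFDerivAt (𝓡 3) 𝓘(ℝ, 𝔼 2)
      ((fibreCoord h) ∘ Subtype.val : ↥((𝓡∂ 4).boundary W) → 𝔼 2) (liftPt h θ)
      ((mfderiv (𝓡∂ 4) 𝓘(ℝ, 𝔼 2) (fibreCoord h) (h.attachingCircle θ)).comp (consZeroL 3)) :=
    hP.hasMFDerivAt.comp (liftPt h θ) (hasMFDerivAt_subtype_val_boundary (n := 3) (liftPt h θ))
  -- `d(snd ∘ Q) = snd ∘ dQ`
  have h2 : HasMFDerivAt (𝓡 3) 𝓘(ℝ, 𝔼 2)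
      (Prod.snd ∘ h.boundaryTube.toHomeo.symm : ↥((𝓡∂ 4).boundary W) → 𝔼 2) (liftPt h θ)
      ((ContinuousLinearMap.snd ℝ (𝔼 1) (𝔼 2)).comp
        (mfderiv (𝓡 3) I𝕋₁ h.boundaryTube.toHomeo.symm (liftPt h θ))) := by
    have hs := hasMFDerivAt_snd (I := 𝓡 1) (I' := 𝓘(ℝ, 𝔼 2))
      (h.boundaryTube.toHomeo.symm (liftPt h θ))
    exact hs.comp (liftPt h θ) hQ.hasMFDerivAt
  have hfun : ((fibreCoord h) ∘ Subtype.val : ↥((𝓡∂ 4).boundary W) → 𝔼 2) =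
      Prod.snd ∘ h.boundaryTube.toHomeo.symm := rfl
  rw [hfun] at h1
  have heq := h1.mfderiv.symm.trans h2.mfderiv
  have key : mfderiv (𝓡∂ 4) 𝓘(ℝ, 𝔼 2) (fibreCoord h) (h.attachingCircle θ)
      (consZeroL 3 (tailFraming ν θ)) =
      (mfderiv (𝓡 3) I𝕋₁ h.boundaryTube.toHomeo.symm (liftPt h θ) (tailFraming ν θ)).2 :=
    DFunLike.congr_fun heq (tailFraming ν θ)
  have e2 : consZeroL 3 (tailFraming ν θ) = ν θ := consZeroL_tailFraming hν θ
  exact (congrArg (mfderiv (𝓡∂ 4) 𝓘(ℝ, 𝔼 2) (fibreCoord h) (h.attachingCircle θ)) e2).symm.trans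
    key

/-- **The velocity of the attaching circle read through `d(h♭⁻¹)` is horizontal and nonzero**:
`d(h♭⁻¹)(K̇₀) = (ċ, 0)` with `ċ = d(circlePt) ≠ 0` (`h♭⁻¹ ∘ K₀ ∘ circlePt = (circlePt, 0)`).
[folklore] -/
theorem mfderiv_symm_liftVel (h : HandleAttachingMap 3 2 W) (hK : IsBoundaryKnot h.attachingCircle)
    (θ : 𝕊 1) :
    mfderiv (𝓡 3) I𝕋₁ h.boundaryTube.toHomeo.symm (liftPt h θ) (liftVel hK θ) =
      ((mfderiv 𝓘(ℝ, ℝ) (𝓡 1) circlePt (angA θ) (1 : ℝ), (0 : 𝔼 2)) :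
        TangentSpace I𝕋₁ (h.boundaryTube.toHomeo.symm (liftPt h θ))) := by
  set t : ℝ := angA θ with ht
  have hθ : circlePt t = θ := circlePt_angA θ
  -- the lifted loop, in `↥(∂W)`
  set γ : ℝ → ↥((𝓡∂ 4).boundary W) := fun s => liftPt h (circlePt s) with hγ_def
  have hγs : ContMDiff 𝓘(ℝ, ℝ) (𝓡 3) ∞ γ := by
    have e : γ = fun s => h.boundaryTube.core (circlePt s) :=
      funext fun s => liftPt_eq_core h (circlePt s)
    rw [e]
    exact h.boundaryTube.contMDiff_core.comp contMDiff_circlePt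
  have hvel : liftVel hK θ = mfderiv 𝓘(ℝ, ℝ) (𝓡 3) γ t (1 : ℝ) := rfl
  have hQ : MDifferentiableAt (𝓡 3) I𝕋₁ h.boundaryTube.toHomeo.symm (γ t) :=
    (h.boundaryTube.contMDiffAt_symm (liftPt_mem_target h _)).mdifferentiableAt (by simp)
  have hL : MDifferentiableAt 𝓘(ℝ, ℝ) (𝓡 3) γ t := (hγs t).mdifferentiableAt (by simp)
  -- the composite `Q ∘ γ` is `s ↦ (circlePt s, 0)`
  have hcomp : (h.boundaryTube.toHomeo.symm ∘ γ) = fun s => (circlePt s, (0 : 𝔼 2)) := by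
    funext s
    show h.boundaryTube.toHomeo.symm (liftPt h (circlePt s)) = _
    rw [liftPt_eq_core, CircleTube.symm_core]
  have hc : MDifferentiableAt 𝓘(ℝ, ℝ) (𝓡 1) circlePt t :=
    contMDiff_circlePt.contMDiffAt.mdifferentiableAt (by simp)
  have hpair : HasMFDerivAt 𝓘(ℝ, ℝ) I𝕋₁ (fun s : ℝ => (circlePt s, (0 : 𝔼 2))) t
      ((mfderiv 𝓘(ℝ, ℝ) (𝓡 1) circlePt t).prod (0 : TangentSpace 𝓘(ℝ, ℝ) t →L[ℝ] 𝔼 2)) := by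
    have h0 : HasMFDerivAt 𝓘(ℝ, ℝ) 𝓘(ℝ, 𝔼 2) (fun _ : ℝ => (0 : 𝔼 2)) t
        (0 : TangentSpace 𝓘(ℝ, ℝ) t →L[ℝ] 𝔼 2) := hasMFDerivAt_const (0 : 𝔼 2) t
    exact hc.hasMFDerivAt.prodMk h0
  have hchain : mfderiv 𝓘(ℝ, ℝ) I𝕋₁ (h.boundaryTube.toHomeo.symm ∘ γ) t =
      (mfderiv (𝓡 3) I𝕋₁ h.boundaryTube.toHomeo.symm (γ t)).comp
        (mfderiv 𝓘(ℝ, ℝ) (𝓡 3) γ t) := mfderiv_comp t hQ hL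
  have hkey : (mfderiv (𝓡 3) I𝕋₁ h.boundaryTube.toHomeo.symm (γ t))
      (mfderiv 𝓘(ℝ, ℝ) (𝓡 3) γ t (1 : ℝ)) =
      ((mfderiv 𝓘(ℝ, ℝ) (𝓡 1) circlePt t (1 : ℝ), (0 : 𝔼 2)) :
        TangentSpace I𝕋₁ (h.boundaryTube.toHomeo.symm (γ t))) := by
    have e1 : (mfderiv (𝓡 3) I𝕋₁ h.boundaryTube.toHomeo.symm (γ t))
        (mfderiv 𝓘(ℝ, ℝ) (𝓡 3) γ t (1 : ℝ)) =
        mfderiv 𝓘(ℝ, ℝ) I𝕋₁ (h.boundaryTube.toHomeo.symm ∘ γ) t (1 : ℝ) := by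
      rw [hchain]; rfl
    rw [e1, hcomp, hpair.mfderiv]
    rfl
  rw [hvel]
  clear_value t
  subst hθ
  exact hkey

omit [IsManifold (𝓡∂ 4) ∞ W] in
/-- The velocity `d(circlePt)/dt` is nonzero. [folklore] -/
theorem mfderiv_circlePt_one_ne_zero (t : ℝ) :
    mfderiv 𝓘(ℝ, ℝ) (𝓡 1) circlePt t (1 : ℝ) ≠ 0 := fun h0 =>
  (one_ne_zero (α := ℝ)) ((mfderiv_circlePt_injective t) (h0.trans (map_zero _).symm))

omit [IsManifold (𝓡∂ 4) ∞ W] in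
/-- In `ℝ¹` every vector is a multiple of a nonzero one. [folklore] -/
theorem exists_smul_eq_of_ne_zero_fin_one {a : 𝔼 1} (ha : a ≠ 0) (x : 𝔼 1) : ∃ r : ℝ, x = r • a := by
  have ha0 : a 0 ≠ 0 := fun h0 => ha (by ext i; fin_cases i; simpa using h0)
  refine ⟨x 0 / a 0, ?_⟩
  ext i
  fin_cases i
  simp [div_mul_cancel₀ _ ha0]

/-- **A framing of the attaching circle, read through the fibre coordinate of `h̄`, never
vanishes**: `ν` is tangent to `∂W` and nowhere tangent to `K`
(`linearIndependent_liftVel_tailFraming`), `d(h♭⁻¹)` is injective on `T∂W` along `K`, and a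
vector with vanishing fibre component is horizontal, i.e. a multiple of the image of the
velocity of `K`. [folklore] -/
theorem mfderiv_fibreCoord_ne_zero (h : HandleAttachingMap 3 2 W)
    (hK : IsBoundaryKnot h.attachingCircle) {ν : 𝕊 1 → E4}
    (hν : IsKnotFraming h.attachingCircle ν) (θ : 𝕊 1) :
    mfderiv (𝓡∂ 4) 𝓘(ℝ, 𝔼 2) (fibreCoord h) (h.attachingCircle θ) (ν θ) ≠ 0 := by
  rw [mfderiv_fibreCoord_eq_snd_mfderiv_symm h hν θ]
  intro h2
  set M := mfderiv (𝓡 3) I𝕋₁ h.boundaryTube.toHomeo.symm (liftPt h θ) with hM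
  set v : 𝔼 3 := tailFraming ν θ with hv
  set ℓ : 𝔼 3 := liftVel hK θ with hℓ
  set a : 𝔼 1 := mfderiv 𝓘(ℝ, ℝ) (𝓡 1) circlePt (angA θ) (1 : ℝ) with ha
  have haz : a ≠ 0 := mfderiv_circlePt_one_ne_zero _
  have hMℓ : M ℓ = ((a, (0 : 𝔼 2)) : TangentSpace I𝕋₁ (h.boundaryTube.toHomeo.symm (liftPt h θ))) :=
    mfderiv_symm_liftVel h hK θ
  -- the image of `v` is horizontal, hence a multiple of the image of `ℓ`
  obtain ⟨r, hr⟩ := exists_smul_eq_of_ne_zero_fin_one haz (M v).1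
  have hMv : M v = M (r • ℓ) := by
    have e1a : M v =
        ((r • a, (0 : 𝔼 2)) : TangentSpace I𝕋₁ (h.boundaryTube.toHomeo.symm (liftPt h θ))) :=
      Prod.ext hr h2
    have e1b : r • M ℓ =
        ((r • a, (0 : 𝔼 2)) : TangentSpace I𝕋₁ (h.boundaryTube.toHomeo.symm (liftPt h θ))) := by
      have e := congrArg
        (fun z : TangentSpace I𝕋₁ (h.boundaryTube.toHomeo.symm (liftPt h θ)) => r • z) hMℓ
      exact e.trans (Prod.ext rfl (smul_zero r))
    exact (e1a.trans e1b.symm).trans (M.map_smul r ℓ).symm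
  -- injectivity of `dQ` and independence of `ℓ`, `v`
  have hinj : Injective M := h.boundaryTube.injective_mfderiv_symm (liftPt_mem_target h θ)
  have hvr : v = r • ℓ := hinj hMv
  have hli := linearIndependent_liftVel_tailFraming hK hν θ
  rw [LinearIndependent.pair_iff] at hli
  have hsum : r • liftVel hK θ + (-1 : ℝ) • tailFraming ν θ = 0 := by
    show r • ℓ + (-1 : ℝ) • v = 0
    rw [hvr, neg_one_smul, add_neg_cancel]
  have := (hli r (-1) hsum).2
  norm_num at this

/-! ### Joint continuity along a framing family -/

/-- **Framings of a family, read through the fibre coordinate, are jointly continuous**: the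
family is continuous into `TW` on `[0, 1] × S¹` and `d(x_μ ∘ h̄⁻¹)` is a continuous bundle map
over the range of `h̄` (Mathlib's `ContMDiffOn.continuousOn_tangentMapWithin`), with values in
the trivial bundle `T ℝ²`. [folklore] -/
theorem continuousOn_mfderiv_fibreCoord_family (h : HandleAttachingMap 3 2 W) {K : 𝕊 1 → W}
    (hKr : ∀ θ, K θ ∈ range h.toFun) {νt : ℝ → 𝕊 1 → E4}
    (hc : ContinuousOn (fun p : ℝ × (𝕊 1) =>
      (TotalSpace.mk' E4 (K p.2) (νt p.1 p.2) : TangentBundle (𝓡∂ 4) W)) (Icc 0 1 ×ˢ univ)) :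
    ContinuousOn (fun p : ℝ × (𝕊 1) =>
      mfderiv (𝓡∂ 4) 𝓘(ℝ, 𝔼 2) (fibreCoord h) (K p.2) (νt p.1 p.2)) (Icc 0 1 ×ˢ univ) := by
  have h1 : ContinuousOn (tangentMapWithin (𝓡∂ 4) 𝓘(ℝ, 𝔼 2) (fibreCoord h) (range h.toFun))
      (TotalSpace.proj ⁻¹' range h.toFun) :=
    (contMDiffOn_fibreCoord h).continuousOn_tangentMapWithin (by simp) h.isOpen_range.uniqueMDiffOn
  have h2 : Continuous fun z : TangentBundle 𝓘(ℝ, 𝔼 2) (𝔼 2) => z.2 :=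
    continuous_snd.comp (tangentBundleModelSpaceHomeomorph 𝓘(ℝ, 𝔼 2)).continuous
  have hmaps : MapsTo (fun p : ℝ × (𝕊 1) =>
      (TotalSpace.mk' E4 (K p.2) (νt p.1 p.2) : TangentBundle (𝓡∂ 4) W)) (Icc 0 1 ×ˢ univ)
      (TotalSpace.proj ⁻¹' range h.toFun) := fun p _ => hKr p.2
  have h3 := h2.comp_continuousOn (h1.comp hc hmaps)
  refine h3.congr fun p _ => ?_
  show mfderiv (𝓡∂ 4) 𝓘(ℝ, 𝔼 2) (fibreCoord h) (K p.2) (νt p.1 p.2) =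
    mfderivWithin (𝓡∂ 4) 𝓘(ℝ, 𝔼 2) (fibreCoord h) (range h.toFun) (K p.2) (νt p.1 p.2)
  rw [mfderivWithin_of_mem_nhds (h.isOpen_range.mem_nhds (hKr p.2))]

/-! ### The degree of the rotation field vanishes -/

/-- `toC v = 0 ↔ v = 0`. [folklore] -/
theorem toC_eq_zero_iff {v : 𝔼 2} : toC v = 0 ↔ v = 0 := by
  constructor
  · intro h0
    apply toC_injective
    rw [h0]
    apply Complex.ext <;> simp [toC]
  · rintro rfl
    apply Complex.ext <;> simp [toC]

/-- The loops `t ↦ circlePt t` close up: `circlePt 1 = circlePt 0`. [folklore] -/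
theorem circlePt_one_eq_zero : circlePt 1 = circlePt 0 := by
  rw [← circlePt_add_one 0, zero_add]

/-- `toC (r • R(ψ) e₀) = exp (log r + i ψ)` for `r > 0`. [folklore] -/
theorem toC_smul_rotPlane_planeE0 {r : ℝ} (hr : 0 < r) (ψ : ℝ) :
    toC (r • rotPlane ψ planeE0) = Complex.exp ((Real.log r : ℂ) + (ψ : ℂ) * Complex.I) := by
  apply Complex.ext
  · simp [toC, Complex.exp_re, Real.exp_log hr]
  · simp [toC, Complex.exp_im, Real.exp_log hr]

/-- **Homotopic handle framings give a rotation field of degree zero.**  Let `g`, `h̄` be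
attaching maps of 2-handles on `W` with the same attaching circle `K` and handle framings
homotopic through framings of `K` (`FramingHomotopic K ν_g ν_h̄`).  Then the rotation field
`u(x) = A(x)e₀/‖A(x)e₀‖` of the transition `h♭⁻¹ ∘ g♭` of the boundary tubes has a smooth angle
function: `u(x) = R(β x) e₀` with `β : S¹ → ℝ` smooth.  (Read through `d(x_μ ∘ h̄⁻¹)` the
framing family is a free homotopy of loops in `ℝ² ∖ 0` from `A e₀` to the constant `e₀`, so
`wind (A e₀) = 0`; the degree `d` of `u` from `exists_int_angle_of_rotationField` is this
winding number.) [cite: GompfStipsicz1999, §4.5] -/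
theorem exists_angle_of_framingHomotopic (g h : HandleAttachingMap 3 2 W)
    (hcirc : g.attachingCircle = h.attachingCircle)
    (hfr : FramingHomotopic h.attachingCircle g.attachingFraming h.attachingFraming) :
    ∃ β : 𝕊 1 → ℝ, ContMDiff (𝓡 1) 𝓘(ℝ, ℝ) ∞ β ∧
      ∀ x, CircleTube.frameVec g.boundaryTube h.boundaryTube x = rotPlane (β x) planeE0 := by
  have hcore : ∀ x, g.boundaryTube.core x = h.boundaryTube.core x :=
    HandleAttachingMap.boundaryTube_core_eq hcirc
  obtain ⟨hK, νt, hνt, hν1⟩ := hfr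
  -- the plane fields `c s θ = d(x_μ h̄⁻¹)(νt s θ)`
  obtain ⟨c, hc_def⟩ : ∃ c : ℝ → (𝕊 1) → 𝔼 2, c = fun s θ =>
      mfderiv (𝓡∂ 4) 𝓘(ℝ, 𝔼 2) (fibreCoord h) (h.attachingCircle θ) (νt s θ) := ⟨_, rfl⟩
  have hc0 : ∀ θ, c 0 θ = CircleTube.frameCol g.boundaryTube h.boundaryTube θ := fun θ => by
    rw [hc_def]
    show mfderiv (𝓡∂ 4) 𝓘(ℝ, 𝔼 2) (fibreCoord h) (h.attachingCircle θ) (νt 0 θ) = _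
    rw [hνt.apply_zero]
    exact mfderiv_fibreCoord_attachingFraming g h hcirc θ
  have hc1 : ∀ θ, c 1 θ = planeE0 := fun θ => by
    rw [hc_def]
    show mfderiv (𝓡∂ 4) 𝓘(ℝ, 𝔼 2) (fibreCoord h) (h.attachingCircle θ) (νt 1 θ) = _
    rw [hν1]
    exact mfderiv_fibreCoord_attachingFraming_self h θ
  have hne : ∀ s ∈ Icc (0 : ℝ) 1, ∀ θ, c s θ ≠ 0 := by
    rw [hc_def]
    exact fun s hs θ => mfderiv_fibreCoord_ne_zero h hK (hνt.isKnotFraming s hs) θ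
  have hcont : ContinuousOn (fun p : ℝ × (𝕊 1) => c p.1 p.2) (Icc 0 1 ×ˢ univ) := by
    rw [hc_def]
    exact continuousOn_mfderiv_fibreCoord_family h (attachingCircle_mem_range h) hνt.continuousOn
  -- the free homotopy of loops in `ℂ ∖ 0`
  obtain ⟨H, hH_def⟩ : ∃ H : ℝ → ℝ → ℂ, H = fun s t => toC (c s (circlePt t)) := ⟨_, rfl⟩
  have hH : ContinuousOn (uncurry H) (Icc 0 1 ×ˢ Icc 0 1) := by
    have hg : Continuous fun p : ℝ × ℝ => (p.1, circlePt p.2) :=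
      continuous_fst.prodMk (continuous_circlePt.comp continuous_snd)
    have hmaps : MapsTo (fun p : ℝ × ℝ => (p.1, circlePt p.2)) (Icc (0 : ℝ) 1 ×ˢ Icc (0 : ℝ) 1)
        (Icc (0 : ℝ) 1 ×ˢ univ) := fun p hp => ⟨hp.1, mem_univ _⟩
    rw [hH_def]
    exact contDiff_toC.continuous.comp_continuousOn (hcont.comp hg.continuousOn hmaps)
  have hloop : ∀ s ∈ Icc (0 : ℝ) 1, H s 0 = H s 1 := fun s _ => by
    rw [hH_def]
    show toC (c s (circlePt 0)) = toC (c s (circlePt 1))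
    rw [circlePt_one_eq_zero]
  have hHne : ∀ s ∈ Icc (0 : ℝ) 1, ∀ t ∈ Icc (0 : ℝ) 1, H s t ≠ 0 := by
    rw [hH_def]
    exact fun s hs t _ h0 => hne s hs _ (toC_eq_zero_iff.1 h0)
  have hwind := wind_eq_of_homotopy hH hloop hHne
  have hH1 : H 1 = fun _ => toC planeE0 := by
    rw [hH_def]
    funext t
    show toC (c 1 (circlePt t)) = toC planeE0
    rw [hc1]
  have hw0 : wind (H 0) = 0 := by rw [hwind, hH1, wind_const]
  -- the rotation field `u = A e₀ / ‖A e₀‖` and its degree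
  obtain ⟨d, β, hβ, hrot⟩ :=
    exists_int_angle_of_rotationField (CircleTube.contMDiff_frameUnit hcore)
  have hvec : ∀ φ : ℝ, CircleTube.frameVec g.boundaryTube h.boundaryTube (circlePoint φ) =
      rotPlane (β (circlePoint φ) + d * φ) planeE0 := by
    intro φ
    have h1 := hrot φ planeE0
    simp only [planeE0_apply_zero, planeE0_apply_one, one_smul, zero_smul, add_zero] at h1
    calc CircleTube.frameVec g.boundaryTube h.boundaryTube (circlePoint φ)
        = rotPlane (β (circlePoint φ)) (rotPlane (-β (circlePoint φ))
            (CircleTube.frameVec g.boundaryTube h.boundaryTube (circlePoint φ))) :=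
          (rotPlane_rotPlane_neg _ _).symm
      _ = rotPlane (β (circlePoint φ)) (rotPlane (d * φ) planeE0) := by rw [h1]
      _ = rotPlane (β (circlePoint φ) + d * φ) planeE0 := (rotPlane_add _ _ _).symm
  -- the loop `H 0 = toC ∘ A e₀ ∘ circlePt` and its logarithm
  set F : (𝕊 1) → 𝔼 2 := CircleTube.frameCol g.boundaryTube h.boundaryTube with hF_def
  have hFne : ∀ x, F x ≠ 0 := fun x => CircleTube.frameCol_ne_zero hcore x
  have hFc : Continuous F := (CircleTube.contMDiff_frameCol hcore).continuous
  set ψ : ℝ → ℝ := fun t => β (circlePt t) + d * (2 * Real.pi * t) with hψ_def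
  set l : ℝ → ℂ := fun t => (Real.log ‖F (circlePt t)‖ : ℂ) + (ψ t : ℂ) * Complex.I with hl_def
  have hl : ContinuousOn l (Icc 0 1) := by
    have h1 : Continuous fun t : ℝ => Real.log ‖F (circlePt t)‖ :=
      (continuous_norm.comp (hFc.comp continuous_circlePt)).log fun t =>
        (norm_pos_iff.2 (hFne _)).ne'
    have h2 : Continuous ψ :=
      (hβ.continuous.comp continuous_circlePt).add
        (continuous_const.mul (continuous_const.mul continuous_id))
    exact ((Complex.continuous_ofReal.comp h1).add
      ((Complex.continuous_ofReal.comp h2).mul continuous_const)).continuousOn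
  have hexp : ∀ t ∈ Icc (0 : ℝ) 1, Complex.exp (l t) = H 0 t := by
    intro t _
    have hpos : 0 < ‖F (circlePt t)‖ := norm_pos_iff.2 (hFne _)
    have hFt : F (circlePt t) = ‖F (circlePt t)‖ • rotPlane (ψ t) planeE0 := by
      have h1 : ‖F (circlePt t)‖ • CircleTube.frameVec g.boundaryTube h.boundaryTube (circlePt t) =
          F (circlePt t) := NormedSpace.norm_smul_normalize _
      have h2 : CircleTube.frameVec g.boundaryTube h.boundaryTube (circlePt t) =
          rotPlane (ψ t) planeE0 := by
        rw [circlePt_eq_circlePoint, hvec]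
        rfl
      rw [h2] at h1
      exact h1.symm
    rw [hH_def]
    show Complex.exp (l t) = toC (c 0 (circlePt t))
    rw [hc0, hFt, toC_smul_rotPlane_planeE0 hpos]
  have h01 : H 0 0 = H 0 1 := hloop 0 ⟨le_rfl, zero_le_one⟩
  have hspec := wind_spec hl hexp h01
  rw [hw0, Int.cast_zero, zero_mul] at hspec
  have hdiff : l 1 - l 0 = (d : ℂ) * (2 * Real.pi * Complex.I) := by
    simp only [hl_def, hψ_def, circlePt_one_eq_zero]
    push_cast
    ring
  rw [hdiff] at hspec
  have hd : d = 0 := by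
    apply int_eq_of_mul_two_pi_I_eq
    rw [hspec, Int.cast_zero, zero_mul]
  -- conclusion
  refine ⟨β, hβ, fun x => ?_⟩
  obtain ⟨φ, rfl⟩ := circlePoint_surjective x
  rw [hvec φ, hd, Int.cast_zero, zero_mul, add_zero]

end FibreCoord


/-! ### The reflection of the second normal coordinate on the tube -/

section Reflection

/-- The sign `±1` attached to a Boolean (`-1` for `true`). [folklore] -/
def boolSign (b : Bool) : ℝ := if b then -1 else 1

/-- `boolSign b * boolSign b = 1`. [folklore] -/
theorem boolSign_mul_self (b : Bool) : boolSign b * boolSign b = 1 := by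
  cases b <;> simp [boolSign]

/-- **The reflected fibre vector** `(w₀, ± w₁)`. [folklore] -/
def reflVec (b : Bool) (w : 𝔼 2) : 𝔼 2 := w 0 • planeE0 + (boolSign b * w 1) • planeE1

/-- First coordinate of the reflected vector. [folklore] -/
@[simp] theorem reflVec_apply_zero (b : Bool) (w : 𝔼 2) : reflVec b w 0 = w 0 := by
  simp [reflVec]

/-- Second coordinate of the reflected vector. [folklore] -/
@[simp] theorem reflVec_apply_one (b : Bool) (w : 𝔼 2) : reflVec b w 1 = boolSign b * w 1 := by
  simp [reflVec]

/-- The reflection preserves the norm. [folklore] -/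
@[simp] theorem norm_reflVec (b : Bool) (w : 𝔼 2) : ‖reflVec b w‖ = ‖w‖ := by
  have h1 : ‖reflVec b w‖ ^ 2 = ‖w‖ ^ 2 := by
    rw [EuclideanSpace.real_norm_sq_eq, EuclideanSpace.real_norm_sq_eq, Fin.sum_univ_two,
      Fin.sum_univ_two, reflVec_apply_zero, reflVec_apply_one, mul_pow, sq (boolSign b),
      boolSign_mul_self, one_mul]
  nlinarith [norm_nonneg (reflVec b w), norm_nonneg w, sq_nonneg (‖reflVec b w‖ - ‖w‖),
    sq_nonneg (‖reflVec b w‖ + ‖w‖)]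

/-- **The handle symmetry `muReflection b` acts on the vectors `mkVec θ v s` by reflecting the
fibre.** [folklore] -/
theorem muReflection_mkVec (b : Bool) (θ : 𝕊 1) (v : 𝔼 2) (s : ℝ) :
    muReflection b (mkVec (θ : 𝔼 2) v s) = mkVec (θ : 𝔼 2) (reflVec b v) s := by
  ext i
  rw [muReflection, diagonalIsometry_apply]
  fin_cases i <;> simp [muReflectionSigns, mkVec, boolSign, norm_reflVec]

/-- **The handle symmetry `muReflection b` maps the depth line of fibre `v` to the depth line
of the reflected fibre.** [folklore] -/
theorem tubeCongr_muReflection_depthLine (b : Bool) (θ : 𝕊 1) (v : 𝔼 2) {s : ℝ} (hs : 0 ≤ s)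
    (h : 0 < 1 - s - ‖v‖ ^ 2) :
    tubeCongr (muReflection b) (isHandleSymmetry_muReflection b) (depthLine θ v s) =
      depthLine θ (reflVec b v) s := by
  have h' : 0 < 1 - s - ‖reflVec b v‖ ^ 2 := by rwa [norm_reflVec]
  apply Subtype.ext; apply Subtype.ext
  rw [coe_coe_tubeCongr]
  show muReflection b (tubeVec (depthLine θ v s)) = tubeVec (depthLine θ (reflVec b v) s)
  rw [tubeVec_depthLine θ v hs h, tubeVec_depthLine θ _ hs h', muReflection_mkVec]

end Reflection

/-! ### Tubes: a uniform fibre radius inside the transition domain -/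

section Tubes

variable {Y : Type*} [TopologicalSpace Y] [ChartedSpace (𝔼 3) Y]

/-- **A uniform tube inside the transition domain**: for two tubes with the same core there is
`r > 0` with `(x, w) ∈ transitionDom` (so `Φ₁ (x, w) ∈ target Φ₂`) for all `x` and `‖w‖ < r`
(tube lemma over the compact `S¹`). [folklore] -/
theorem exists_pos_forall_mem_transitionDom {Φ₁ Φ₂ : CircleTube Y}
    (hcore : ∀ θ, Φ₁.core θ = Φ₂.core θ) :
    ∃ r : ℝ, 0 < r ∧ ∀ (x : 𝕊 1) (w : 𝔼 2), ‖w‖ < r → (x, w) ∈ CircleTube.transitionDom Φ₁ Φ₂ := by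
  have hsub : (univ : Set (𝕊 1)) ×ˢ ({0} : Set (𝔼 2)) ⊆ CircleTube.transitionDom Φ₁ Φ₂ := by
    rintro ⟨x, w⟩ ⟨-, hw⟩
    rw [mem_singleton_iff] at hw
    subst hw
    exact CircleTube.mem_transitionDom_zero hcore x
  obtain ⟨u₀, v₀, -, hv₀, hu₀, h0v₀, huv⟩ := generalized_tube_lemma isCompact_univ
    isCompact_singleton (CircleTube.isOpen_transitionDom Φ₁ Φ₂) hsub
  obtain ⟨r, hr, hrv⟩ := Metric.isOpen_iff.1 hv₀ 0 (h0v₀ rfl)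
  exact ⟨r, hr, fun x w hw => huv ⟨hu₀ (mem_univ x), hrv (mem_ball_zero_iff.2 hw)⟩⟩

/-- **Composing diffeotopies with pairwise disjoint supports, one for each tube of a finite
family.**  Given tubes `Φ₁ i`, `Φ₂ i` with the targets of the `Φ₂ i` pairwise disjoint, fibre
maps `ρ i` and radii `r i` such that `Φ₁ i (x, w)` and `Φ₂ i (x, ρ i w)` lie in the target of
`Φ₂ i` for `‖w‖ < r i`, and for each `i` a diffeotopy supported in the target of `Φ₂ i` taking
`Φ₁ i (x, w)` to `Φ₂ i (x, ρ i w)` at time `1` (`‖w‖ < r i`), their composite does so for every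
`i` at once and is supported in the union of the targets. [folklore] -/
theorem exists_diffeotopy_family {ι : Type*} [Finite ι] (Φ₁ Φ₂ : ι → CircleTube Y)
    (ρ : ι → 𝔼 2 → 𝔼 2) (r : ι → ℝ)
    (hdisj : Pairwise fun i j => Disjoint (Φ₂ i).toHomeo.target (Φ₂ j).toHomeo.target)
    (hmem₁ : ∀ i (x : 𝕊 1) (w : 𝔼 2), ‖w‖ < r i → (Φ₁ i).toHomeo (x, w) ∈ (Φ₂ i).toHomeo.target)
    (hmem₂ : ∀ i (x : 𝕊 1) (w : 𝔼 2), ‖w‖ < r i →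
      (Φ₂ i).toHomeo (x, ρ i w) ∈ (Φ₂ i).toHomeo.target)
    (hD : ∀ i, ∃ D : Diffeotopy (𝓡 3) Y, (∀ t y, y ∉ (Φ₂ i).toHomeo.target → D.toFun t y = y) ∧
      ∀ (x : 𝕊 1) (w : 𝔼 2), ‖w‖ < r i →
        D.toFun 1 ((Φ₁ i).toHomeo (x, w)) = (Φ₂ i).toHomeo (x, ρ i w)) :
    ∃ D : Diffeotopy (𝓡 3) Y, (∀ t y, (∀ i, y ∉ (Φ₂ i).toHomeo.target) → D.toFun t y = y) ∧
      ∀ i (x : 𝕊 1) (w : 𝔼 2), ‖w‖ < r i →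
        D.toFun 1 ((Φ₁ i).toHomeo (x, w)) = (Φ₂ i).toHomeo (x, ρ i w) := by
  classical
  choose D hDout hDeq using hD
  suffices key : ∀ S : Finset ι, ∃ DS : Diffeotopy (𝓡 3) Y,
      (∀ t y, (∀ i ∈ S, y ∉ (Φ₂ i).toHomeo.target) → DS.toFun t y = y) ∧
      ∀ i ∈ S, ∀ (x : 𝕊 1) (w : 𝔼 2), ‖w‖ < r i →
        DS.toFun 1 ((Φ₁ i).toHomeo (x, w)) = (Φ₂ i).toHomeo (x, ρ i w) by
    haveI := Fintype.ofFinite ι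
    obtain ⟨DS, h1, h2⟩ := key Finset.univ
    exact ⟨DS, fun t y hy => h1 t y fun i _ => hy i, fun i => h2 i (Finset.mem_univ i)⟩
  intro S
  induction S using Finset.induction_on with
  | empty =>
    exact ⟨Diffeotopy.refl (𝓡 3) Y, fun t y _ => rfl, fun i hi => absurd hi (by simp)⟩
  | @insert j S hj ih =>
    obtain ⟨DS, hS1, hS2⟩ := ih
    refine ⟨DS.trans (D j), fun t y hy => ?_, fun i hi x w hw => ?_⟩
    · rw [Diffeotopy.trans_toFun, comp_apply,
        hS1 t y (fun i hi' => hy i (Finset.mem_insert_of_mem hi')),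
        hDout j t y (hy j (Finset.mem_insert_self j S))]
    · rw [Finset.mem_insert] at hi
      rw [Diffeotopy.trans_toFun, comp_apply]
      rcases hi with hij | hi
      · subst hij
        have hfix : DS.toFun 1 ((Φ₁ i).toHomeo (x, w)) = (Φ₁ i).toHomeo (x, w) :=
          hS1 1 _ fun i' hi' hmem' =>
            Set.disjoint_left.1 (hdisj (show i' ≠ i from fun e => hj (e ▸ hi'))) hmem'
              (hmem₁ i x w hw)
        rw [hfix, hDeq i x w hw]
      · rw [hS2 i hi x w hw]
        exact hDout j 1 _ fun hmem' =>
          Set.disjoint_left.1 (hdisj (show i ≠ j from fun e => hj (e ▸ hi))) (hmem₂ i x w hw) hmem'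

end Tubes

/-! ### The boundary tubes of `g i` and `h̄ i`: a diffeotopy of `∂W` on each component -/

section Component

variable {W : Type} [TopologicalSpace W] [T2Space W] [ChartedSpace (EuclideanHalfSpace 4) W]
  [IsManifold (𝓡∂ 4) ∞ W]

/-- **On one component: a diffeotopy of `∂W`, supported in the boundary tube of `h̄`, taking the
boundary tube of `g` to that of `h̄` up to a constant reflection of the fibre**, for attaching
maps `g`, `h̄` with the same attaching circle and homotopic handle framings
(`exists_angle_of_framingHomotopic` + `CircleTube.exists_diffeotopy_reflect`).
[cite: Kosinski1993, III (3.5) and VI §5] -/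
theorem exists_diffeotopy_boundaryTube (g h : HandleAttachingMap 3 2 W)
    (hcirc : g.attachingCircle = h.attachingCircle)
    (hfr : FramingHomotopic h.attachingCircle g.attachingFraming h.attachingFraming) :
    ∃ (D : Diffeotopy (𝓡 3) ↥((𝓡∂ 4).boundary W)) (b : Bool) (r : ℝ), 0 < r ∧ r ≤ 1 ∧
      (∀ t y, y ∉ h.boundaryTube.toHomeo.target → D.toFun t y = y) ∧
      (∀ (x : 𝕊 1) (w : 𝔼 2), ‖w‖ < r →
        g.boundaryTube.toHomeo (x, w) ∈ h.boundaryTube.toHomeo.target) ∧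
      ∀ (x : 𝕊 1) (w : 𝔼 2), ‖w‖ < r →
        D.toFun 1 (g.boundaryTube.toHomeo (x, w)) = h.boundaryTube.toHomeo (x, reflVec b w) := by
  have hcore : ∀ x, g.boundaryTube.core x = h.boundaryTube.core x :=
    HandleAttachingMap.boundaryTube_core_eq hcirc
  obtain ⟨s, hs, hsgn⟩ := CircleTube.exists_frameSign hcore
  obtain ⟨β, hβ, hang⟩ := exists_angle_of_framingHomotopic g h hcirc hfr
  obtain ⟨D, r, hr, hDout, hD⟩ := CircleTube.exists_diffeotopy_reflect hcore hs hsgn hβ hang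
  obtain ⟨r₀, hr₀, hdom⟩ := exists_pos_forall_mem_transitionDom hcore
  -- the sign as a Boolean
  have hs' : s = 1 ∨ s = -1 := mul_self_eq_one_iff.1 (by rw [← sq]; exact hs)
  obtain ⟨b, hb⟩ : ∃ b : Bool, boolSign b = s := by
    rcases hs' with rfl | rfl
    · exact ⟨false, by simp [boolSign]⟩
    · exact ⟨true, by simp [boolSign]⟩
  refine ⟨D, b, min (min r r₀) 1, lt_min (lt_min hr hr₀) one_pos, min_le_right _ _, hDout,
    fun x w hw => ?_, fun x w hw => ?_⟩
  · exact (hdom x w (hw.trans_le ((min_le_left _ _).trans (min_le_right _ _)))).2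
  · rw [hD x w (hw.trans_le ((min_le_left _ _).trans (min_le_left _ _))), reflVec, hb]

end Component

/-! ### Step 2: same circles, homotopic framings -/

section SameCircle

variable {W P : Type} [TopologicalSpace W] [T2Space W] [ChartedSpace (EuclideanHalfSpace 4) W]
  [IsManifold (𝓡∂ 4) ∞ W] [CompactSpace W] [TopologicalSpace P]
  [ChartedSpace (EuclideanHalfSpace 4) P] [IsManifold (𝓡∂ 4) ∞ P]

/-- `lamSq` on the tube in the coordinates depth/fibre: `|y_λ|² = 1 - depth - ‖fibre‖²`.
[folklore] -/
theorem lamSq_tubeVec_eq (y : 𝕋) : lamSq 2 (tubeVec y) = 1 - tubeDepth y - ‖tubeFibre y‖ ^ 2 := by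
  rw [← norm_lamPart_sq, norm_lamPart_sq_eq]

/-- **The comparison diffeomorphism.**  For two finite families `g`, `h̄` of attaching maps of
2-handles on the compact `W`, each with pairwise disjoint ranges, with the same attaching circles
and homotopic handle framings, there are a self-diffeomorphism `Ξ` of `W`, signs `b i` and
`ε > 0` with `Ξ (g i y) = (h̄ i ∘ μ_{b i}) y` for all `y ∈ T` with `|y_λ|² > 1 - ε`
(`μ_b = muReflection b` the reflection of the second normal coordinate): `Ξ = G ∘ Ψ`, `Ψ`
matching the collars adapted to `g` and `h̄` and `G` the slide over the `h̄`-collar of the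
composite of the tube diffeotopies of `∂W`. [cite: Kosinski1993, VI §5 and III (3.5)] -/
theorem exists_diffeomorph_eq_reframe {ι : Type} [Finite ι] [Nonempty ι]
    (g h : ι → HandleAttachingMap 3 2 W)
    (hcirc : ∀ i, (g i).attachingCircle = (h i).attachingCircle)
    (hfr : ∀ i, FramingHomotopic (h i).attachingCircle (g i).attachingFraming (h i).attachingFraming)
    (hdisjg : Pairwise fun i j => Disjoint (range (g i).toFun) (range (g j).toFun))
    (hdisjh : Pairwise fun i j => Disjoint (range (h i).toFun) (range (h j).toFun)) :
    ∃ (Ξ : W ≃ₘ⟮𝓡∂ 4, 𝓡∂ 4⟯ W) (b : ι → Bool) (ε : ℝ), 0 < ε ∧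
      ∀ i (y : 𝕋), 1 - ε < lamSq 2 (tubeVec y) →
        Ξ ((g i).toFun y) =
          ((h i).reframe (muReflection (b i)) (isHandleSymmetry_muReflection (b i))).toFun y := by
  classical
  -- the boundary datum `∂W`: nonempty (it contains an attaching circle) and compact
  set bd := BoundaryManifold.boundaryData 3 W with hbd
  obtain ⟨i₀⟩ := (inferInstance : Nonempty ι)
  haveI : Nonempty bd.carrier := ⟨liftPt (h i₀) (circlePt 0)⟩
  haveI : CompactSpace bd.carrier := bd.compactSpace_carrier
  -- flow-outs adapted to `g` and to `h`, and their collars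
  obtain ⟨Dg, Γg, hΓg⟩ := HandleAttachingMap.exists_adapted_flowout g hdisjg
  obtain ⟨Dh, Γh, hΓh⟩ := HandleAttachingMap.exists_adapted_flowout h hdisjh
  set cg := Γg.openCollarData bd with hcg
  set ch := Γh.openCollarData bd with hch
  have hag : 0 < Γg.a := Γg.a_pos
  have hah : 0 < Γh.a := Γh.a_pos
  -- collar matching: `Ψ (Fl_g m t) = Fl_h m t` for small `t`
  obtain ⟨Ψ, -, δ, hδ, hΨ⟩ := BoundaryData.OpenCollarData.exists_diffeomorph_apply_eq (n := 2)
    cg ch (l₁ := 2 / Γg.a) (by positivity) (l₂ := 2 / Γh.a) (by positivity)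
  have hΨFl : ∀ (m : ↥((𝓡∂ 4).boundary W)) (t : ℝ), t ∈ Ico 0 δ →
      Ψ (Γg.Fl (m : W) t) = Γh.Fl (m : W) t := by
    intro m t ht
    have e := hΨ m t ht
    have hag' : Γg.a ≠ 0 := hag.ne'
    have hah' : Γh.a ≠ 0 := hah.ne'
    have e1 : 2 / Γg.a * t * (Γg.a / 2) = t := by field_simp
    have e2 : 2 / Γh.a * t * (Γh.a / 2) = t := by field_simp
    change Ψ (Γg.Fl (m : W) (2 / Γg.a * t * (Γg.a / 2))) = Γh.Fl (m : W) (2 / Γh.a * t * (Γh.a / 2))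
      at e
    rwa [e1, e2] at e
  -- the tube diffeotopies of `∂W`, component by component, and their composite
  have hcomp := fun i => exists_diffeotopy_boundaryTube (g i) (h i) (hcirc i) (hfr i)
  choose D b r hr hr1 hDout hmem hDeq using hcomp
  have hdisjT : Pairwise fun i j =>
      Disjoint (h i).boundaryTube.toHomeo.target (h j).boundaryTube.toHomeo.target :=
    fun i j hij => HandleAttachingMap.disjoint_boundaryTube_target (hdisjh hij)
  have hmem₂ : ∀ i (x : 𝕊 1) (w : 𝔼 2), ‖w‖ < r i →
      (h i).boundaryTube.toHomeo (x, reflVec (b i) w) ∈ (h i).boundaryTube.toHomeo.target :=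
    fun i x w hw => (h i).boundaryTube.toHomeo.map_source
      ((h i).boundaryTube.mem_source_iff.2 (by rw [norm_reflVec]; exact hw.trans_le (hr1 i)))
  obtain ⟨Dt, -, hDt⟩ := exists_diffeotopy_family (fun i => (g i).boundaryTube)
    (fun i => (h i).boundaryTube) (fun i => reflVec (b i)) r hdisjT hmem hmem₂
    fun i => ⟨D i, hDout i, hDeq i⟩
  -- the slide of `Dt` over the `h`-collar
  set G : W ≃ₘ⟮𝓡∂ 4, 𝓡∂ 4⟯ W := (ch.toCollar).slideExtension Dt with hG_def
  have hG : ∀ (m : ↥((𝓡∂ 4).boundary W)) (t' : ℝ) (ht' : t' ∈ Set.Icc (0 : ℝ) 1), t' ≤ 1 / 4 →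
      G (ch.toFun m t') = ch.toFun (Dt.toFun 1 m) t' := by
    intro m t' ht' h4
    have e := (ch.toCollar).slideExtensionFun_apply Dt (m, ⟨t', ht'⟩)
    have e2 : (ch.toCollar).toFun (Dt.slide (m, ⟨t', ht'⟩)) = ch.toFun (Dt.toFun 1 m) t' := by
      show ch.toFun (Dt.toFun (collarProfile t') m) t' = _
      rw [collarProfile_of_le h4]
    exact e.trans e2
  have hGFl : ∀ (m : ↥((𝓡∂ 4).boundary W)) (s' : ℝ), 0 ≤ s' → s' ≤ Γh.a / 8 →
      G (Γh.Fl (m : W) s') = Γh.Fl (Dt.toFun 1 m : W) s' := by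
    intro m s' h0 h8
    have ht' : s' * (2 / Γh.a) ∈ Set.Icc (0 : ℝ) 1 := by
      constructor
      · positivity
      · rw [mul_div_assoc']  -- s' * 2 / a ≤ 1
        rw [div_le_one hah]; linarith
    have ht'4 : s' * (2 / Γh.a) ≤ 1 / 4 := by
      rw [mul_div_assoc', div_le_iff₀ hah]; linarith
    have hah' : Γh.a ≠ 0 := hah.ne'
    have e : s' * (2 / Γh.a) * (Γh.a / 2) = s' := by field_simp
    have key := hG m _ ht' ht'4
    change G (Γh.Fl (m : W) (s' * (2 / Γh.a) * (Γh.a / 2))) =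
      Γh.Fl (Dt.toFun 1 m : W) (s' * (2 / Γh.a) * (Γh.a / 2)) at key
    rwa [e] at key
  -- a uniform fibre radius and a uniform depth
  obtain ⟨i₁, hi₁⟩ := Finite.exists_min r
  set r₁ := r i₁ with hr₁_def
  have hr₁ : 0 < r₁ := hr i₁
  set s₀ : ℝ := min (min (1 / 5) (min Γg.a Γh.a)) (min (δ / 2) (Γh.a / 8)) with hs₀_def
  have hs₀ : 0 < s₀ := by positivity
  set ε : ℝ := min s₀ (min (r₁ ^ 2) (1 / 4)) with hε_def
  have hε : 0 < ε := by positivity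
  refine ⟨Ψ.trans G, b, ε, hε, fun i y hy => ?_⟩
  -- coordinates of `y`
  set θ := tubeAngle y with hθ
  set v := tubeFibre y with hv
  set s := tubeDepth y with hs_def
  have hy' : depthLine θ v s = y := depthLine_tube y
  have hs0 : 0 ≤ s := tubeDepth_nonneg y
  have hlam : lamSq 2 (tubeVec y) = 1 - s - ‖v‖ ^ 2 := lamSq_tubeVec_eq y
  rw [hlam] at hy
  have hv0 := norm_nonneg v
  have hv0' : 0 ≤ ‖v‖ ^ 2 := sq_nonneg _
  have hsε : s < ε := by linarith
  have hvε : ‖v‖ ^ 2 < ε := by linarith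
  have hss₀ : s < s₀ := hsε.trans_le (min_le_left _ _)
  have hv2 : ‖v‖ ^ 2 < r₁ ^ 2 := hvε.trans_le ((min_le_right _ _).trans (min_le_left _ _))
  have hv4 : ‖v‖ ^ 2 < 1 / 4 := hvε.trans_le ((min_le_right _ _).trans (min_le_right _ _))
  have hvr : ‖v‖ < r i := by
    have : ‖v‖ < r₁ := lt_of_pow_lt_pow_left₀ 2 hr₁.le hv2
    exact this.trans_le (hi₁ i)
  have hvhalf : ‖v‖ ≤ 1 / 2 := by
    have h14 : ‖v‖ ^ 2 < (1 / 2 : ℝ) ^ 2 := by norm_num; exact hv4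
    exact (lt_of_pow_lt_pow_left₀ 2 (by norm_num) h14).le
  have hpos : 0 < 1 - s - ‖v‖ ^ 2 := by rw [← hlam]; exact lamSq_tubeVec_pos y
  -- bounds on `s`
  have hs5g : s ∈ Icc (0 : ℝ) (min (1 / 5) Γg.a) := ⟨hs0, by
    refine hss₀.le.trans ?_
    simp only [hs₀_def, le_min_iff, min_le_iff, le_refl, true_or, or_true, and_true]⟩
  have hs5h : s ∈ Icc (0 : ℝ) (min (1 / 5) Γh.a) := ⟨hs0, by
    refine hss₀.le.trans ?_
    simp only [hs₀_def, le_min_iff, min_le_iff, le_refl, true_or, or_true, and_true]⟩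
  have hsδ : s ∈ Ico 0 δ := ⟨hs0, by
    have : s₀ ≤ δ / 2 := (min_le_right _ _).trans (min_le_left _ _)
    linarith⟩
  have hs8 : s ≤ Γh.a / 8 := hss₀.le.trans ((min_le_right _ _).trans (min_le_right _ _))
  -- the boundary points
  set m : ↥((𝓡∂ 4).boundary W) := (g i).boundaryTube.toHomeo (θ, v) with hm
  have hmval : (m : W) = (g i).toFun (depthLine θ v 0) := rfl
  have hDtm : Dt.toFun 1 m = (h i).boundaryTube.toHomeo (θ, reflVec (b i) v) := hDt i θ v hvr
  have hm'val : ((h i).boundaryTube.toHomeo (θ, reflVec (b i) v) : W) =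
      (h i).toFun (depthLine θ (reflVec (b i) v) 0) := rfl
  -- compute the left-hand side
  rw [← hy', Diffeomorph.coe_trans, comp_apply]
  have e1 : (g i).toFun (depthLine θ v s) = Γg.Fl (m : W) s := by
    rw [hmval]; exact (hΓg i θ v hvhalf s hs5g).symm
  have e2 : Ψ (Γg.Fl (m : W) s) = Γh.Fl (m : W) s := hΨFl m s hsδ
  have e3 : G (Γh.Fl (m : W) s) = Γh.Fl (Dt.toFun 1 m : W) s := hGFl m s hs0 hs8
  have e4 : Γh.Fl (Dt.toFun 1 m : W) s = (h i).toFun (depthLine θ (reflVec (b i) v) s) := by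
    rw [hDtm, hm'val]
    exact hΓh i θ (reflVec (b i) v) (by rw [norm_reflVec]; exact hvhalf) s hs5h
  rw [e1, e2, e3, e4, HandleAttachingMap.reframe_apply, tubeCongr_muReflection_depthLine _ θ v hs0 hpos]

/-- **Step 2 of ISO, proved: same attaching circles and homotopic framings.**  If `P` is `W`
with 2-handles attached along `g`, and `h̄` (with pairwise disjoint ranges) has the same attaching
circles as `g` and handle framings homotopic to those of `g`, then `P` is `W` with 2-handles
attached along `h̄` (`exists_diffeomorph_eq_reframe`, transport, locality
`IsMultiAttachment.of_eqOn_near_sphere`, symmetry `isMultiAttachment_reframe_iff`).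
[cite: Kosinski1993, VI §5 (5.1) and VI §6] -/
theorem isMultiAttachment_of_sameCircle' {ι : Type} [Finite ι]
    (g h' : ι → HandleAttachingMap 3 2 W)
    (hcirc : ∀ i, (g i).attachingCircle = (h' i).attachingCircle)
    (hfr : ∀ i, FramingHomotopic (h' i).attachingCircle (g i).attachingFraming (h' i).attachingFraming)
    (hdisj' : Pairwise fun i j => Disjoint (range (h' i).toFun) (range (h' j).toFun))
    (hP : HandleAttachingMap.IsMultiAttachment g (𝓡∂ 4) P) :
    HandleAttachingMap.IsMultiAttachment h' (𝓡∂ 4) P := by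
  have hdisjG : Pairwise fun i j => Disjoint (range (g i).toFun) (range (g j).toFun) := hP.1
  have hdisjρ : ∀ b : ι → Bool, Pairwise fun i j =>
      Disjoint (range ((h' i).reframe (muReflection (b i)) (isHandleSymmetry_muReflection (b i))).toFun)
        (range ((h' j).reframe (muReflection (b j)) (isHandleSymmetry_muReflection (b j))).toFun) := by
    intro b i j hij
    simp only [HandleAttachingMap.range_reframe]
    exact hdisj' hij
  rcases isEmpty_or_nonempty ι with hι | hι
  · -- no handles: locality with a vacuous agreement
    have hPρ := hP.of_eqOn_near_sphere one_pos (h := fun i => (h' i).reframe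
      (muReflection false) (isHandleSymmetry_muReflection false)) (fun i => hι.elim i)
      (hdisjρ fun _ => false)
    exact (HandleAttachingMap.isMultiAttachment_reframe_iff (h := h') (fun _ => muReflection false)
      (fun _ => isHandleSymmetry_muReflection false)).1 hPρ
  · haveI := hι
    obtain ⟨Ξ, b, ε, hε, hΞ⟩ := exists_diffeomorph_eq_reframe g h' hcirc hfr hdisjG hdisj'
    have hP₁ : HandleAttachingMap.IsMultiAttachment (fun i => (g i).transport Ξ) (𝓡∂ 4) P :=
      hP.transport Ξ
    have hPρ := hP₁.of_eqOn_near_sphere hε (h := fun i => (h' i).reframe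
      (muReflection (b i)) (isHandleSymmetry_muReflection (b i))) (fun i y hy => hΞ i y hy)
      (hdisjρ b)
    exact (HandleAttachingMap.isMultiAttachment_reframe_iff (h := h') (fun i => muReflection (b i))
      (fun i => isHandleSymmetry_muReflection (b i))).1 hPρ

end SameCircle

/-! ### ISO holds -/

/-- **Isotopy invariance of 2-handle attachment (ISO), proved.**  Discharge of the named fact
`HandleAttachingMap.isMultiAttachment_of_linkIsotopyInBoundary` of `TwoHandleIsotopy.lean`: if
`P` is `W` with 2-handles attached along `h̄`, and the attaching circles of `h̄` are isotopic
through links in `∂W` to those of `h̄'`, the handle framings being carried to framings homotopic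
to those of `h̄'` (which has pairwise disjoint ranges), then `P` is `W` with 2-handles attached
along `h̄'`.  Step 1 (`exists_isMultiAttachment_sameCircle` with the ambient isotopy theorem
`exists_diffeotopy_of_linkIsotopyInBoundary`) and Step 2 (`isMultiAttachment_of_sameCircle'`).
[cite: Kosinski1993, VI §6 and VIII proof of (1.2)] -/
theorem HandleAttachingMap.isMultiAttachment_of_linkIsotopyInBoundary_holds :
    HandleAttachingMap.isMultiAttachment_of_linkIsotopyInBoundary := by
  intro W P _ _ _ _ _ _ _ _ ι _ h h' Φ νt hν hend hdisj hP
  obtain ⟨g, hPg, hcirc, hfr⟩ := exists_isMultiAttachment_sameCircle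
    exists_diffeotopy_of_linkIsotopyInBoundary h h' Φ νt hν hend hP
  exact isMultiAttachment_of_sameCircle' g h' hcirc hfr hdisj hPg

end Literature.Geometry.Symplectic

end
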